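import Summits.BirchSwinnertonDyer.BirchSwinnertonDyer.Theorems.KolyvaginDepthDoorDepthTableRowsRankThreeNoTwist5
import Summits.BirchSwinnertonDyer.BirchSwinnertonDyer.Theorems.KolyvaginDepthDoorDepthTableRowKitNoTwistDepthTwoOfDatum
import HarnessLib

/-!
# Route `KolyvaginDepthDoor` — DEPTH-TWO (rank-3) depth-table rows OF A DATUM, part 5 of 5:
# C21443a1, C12279a1 (crux `KolyvaginDepthSupply`, stmt-BirchSwinnertonDyer-21765)

Helper file (`--supports stmt-BirchSwinnertonDyer-21765 --as helper`); it closes nothing and BSD is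
not proved by it.

Re-issue of g6's rank-3 rows `C<label>.depthRow_<p>_neg<D>_<ℓ₁>_<ℓ₂>_noTwist` (file
`…DepthTableRowsRankThreeNoTwist5`) in DATUM CURRENCY: the COMPATIBLE-SYSTEM binders
(`d : ∀ m : ℕ, KolyvaginHeegnerData Dt β ι m`, `hσ`, `hS₁`, `hS₂`, `hemb` — not known to be inhabited at
`m = 0`) are REMOVED; the bit is read at ANY single datum `d : KolyvaginHeegnerData Dt β ι (ℓ₁ℓ₂)` (kit
`depthRowTwo_noTwist_of_datum_of_intModel_certificate`; the compatible system through `d` is the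
UNCONDITIONAL theorem `exists_kolyvaginHeegnerSystem_extending`, file `…KolyvaginHeegnerSystem`). The
per-curve side conditions (`intModel`, `hasSurjectiveModNGaloisRep_pow_5`, `not_hasCM`, `heegner_neg7`,
`card_<ℓ>`, `three_le_rank`) are the kernel theorems of the original file, imported. Each row: five named
McCallum/Gross leaves + the bit at `d` ⟹ `corank_{ℤ_5} Ш(E)[5^∞] = 0`, `rank_ℤ E(ℚ) = 3`,
`rank_ℤ E^{(−7)}(ℚ) ≤ 2`, `E(ℚ)[5] = 0`, `Ш(E/ℚ)[5] = 0`, `#Sel^(5)(E/ℚ) = 5³`, `#Sel^(5)(E^{(−7)}/ℚ) ≤ 5²`.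
CONDITIONAL on the five facts and the bit; per-curve; BSD is not proved by it.

References: [Kolyvagin1991MathAnn] Thm. 2.3; [GrossLMS1991] §§3–5, §10; [McCallumLMS1991] §§2–5;
[WZhang2014] Notations (xii).
-/

set_option linter.dupNamespace false

noncomputable section

open scoped Classical

namespace Summit.BirchSwinnertonDyer.BirchSwinnertonDyer.Theorems.KolyvaginDepthDoor

open Literature.NumberTheory.EllipticCurves Literature.NumberTheory.EllipticCurves.ModularForms
  Literature.NumberTheory.EllipticCurves.McCallum1991 WeierstrassCurve
open Summit.BirchSwinnertonDyer.BirchSwinnertonDyer.Theorems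
open Summit.BirchSwinnertonDyer.BirchSwinnertonDyer.Rank2Observatory
open Summit.BirchSwinnertonDyer.BirchSwinnertonDyer.Rank1Residual
open Summit.BirchSwinnertonDyer.Rank1Residual.Additive

namespace C21443a1

/-- **DEPTH-TWO ROW `21443a1`, `(p, d_K, ℓ₁ℓ₂) = (5, -8, 29·479)`, twist-free, without Kolyvagin's
structure theorem, NO SYSTEM (bit at ANY datum).** For `E = 21443a1` (rank `3`), ANY imaginary quadratic `K` with `d_K = -8`, any frame
`(Dt, β, ι)` and ANY single Kolyvagin–Heegner datum `d` (no system, no coherence binders), granted the five named leaves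
(Gross Prop. 5.4 (2); McCallum Lemma 4.3, Prop. 4.4, Lemma 5.3, Prop. 2.2): IF
`d.kolyvaginClass _ 1 ≠ 0` (`d` of conductor `29·479`) THEN `corank_{ℤ_5} Ш(E)[5^∞] = 0`, `rank_ℤ E(ℚ) = 3`,
`rank_ℤ E^{(-8)}(ℚ) ≤ 2`, `E(ℚ)[5] = 0`, `Ш(E/ℚ)[5] = 0`, `#Sel^(5)(E/ℚ) = 5³`, `#Sel^(5)(E^{(-8)}/ℚ) ≤ 5²`.
Every side condition is a kernel theorem. CONDITIONAL on the five facts and the bit; per-curve; BSD is not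
proved by it. [cite: Kolyvagin1991MathAnn, Thm. 2.3] [cite: McCallumLMS1991, §§2–5]
[cite: GrossLMS1991, §5 (5.1)] [cite: CremonaAlgorithms1997, Table 1 (21443a1)] -/
theorem depthRow_5_neg8_29_479_ofDatum
    (h54 : sign_conjAct_kolyvaginClass) (h43 : lemma43_kolyvaginClass_mem_selmerLocalKer)
    (h44 : prop44_localOrder_kolyvaginClass_mul_eq) (h53 : lemma53_selmer_eigen_dependent_at)
    (h22 : prop22_reciprocity_eigen_finset)
    (K : Type) [Field K] [NumberField K] (hK : IsImaginaryQuadratic K)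
    (hD : NumberField.discr K = -8) :
    haveI := isElliptic_of_mem_atlasR3A00 mem_atlas;
    haveI := isGloballyMinimal_of_mem_atlasR3A00 mem_atlas;
    haveI : NeZero ((c21443a1.e.baseChange ℚ).conductorNorm ℤ) := neZero_conductorNorm_of_isElliptic _;
    ∀ (Dt : ModularParametrizationData (c21443a1.e.baseChange ℚ) ((c21443a1.e.baseChange ℚ).conductorNorm ℤ))
      (β : ℤ) (ι : K →+* ℂ) (d : KolyvaginHeegnerData Dt β ι (29 * 479)),
    d.kolyvaginClass (p := 5) (by norm_num) 1 ≠ 0 →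
    (c21443a1.e.baseChange ℚ).shaCorank 5 = 0 ∧ (c21443a1.e.baseChange ℚ).mordellWeilRank = 3 ∧
      ((c21443a1.e.baseChange ℚ).quadraticTwist ((-8 : ℤ) : ℚ)).mordellWeilRank ≤ 2 ∧
      (∀ P : (c21443a1.e.baseChange ℚ).toAffine.Point, 5 • P = 0 → P = 0) ∧
      (∀ x ∈ (c21443a1.e.baseChange ℚ).sha, 5 • x = 0 → x = 0) ∧
      Nat.card ↥(selmerGroup (c21443a1.e.baseChange ℚ) ((5 : ℕ) : ℤ)) = 5 ^ 3 ∧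
      Nat.card ↥(selmerGroup ((c21443a1.e.baseChange ℚ).quadraticTwist ((-8 : ℤ) : ℚ)) ((5 : ℕ) : ℤ)) ≤ 5 ^ 2 := by
  haveI := isElliptic_of_mem_atlasR3A00 mem_atlas
  haveI := isGloballyMinimal_of_mem_atlasR3A00 mem_atlas
  haveI : NeZero ((c21443a1.e.baseChange ℚ).conductorNorm ℤ) := neZero_conductorNorm_of_isElliptic _
  intro Dt β ι d hne
  haveI := Fact.mk (by norm_num : Nat.Prime 5)
  exact depthRowTwo_noTwist_of_datum_of_intModel_certificate intModel h54 h43 h44 h53 h22 not_hasCM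
    three_le_rank 5 (by norm_num) hasSurjectiveModNGaloisRep_pow_5 K hK hD (by norm_num) (by norm_num)
    heegner_neg8
    29 (by norm_num) (by norm_num) (by decide +kernel) (by norm_num) (by norm_num) (by norm_num)
    (by norm_num) (n₁ := 40) card_29 (by norm_num)
    479 (by norm_num) (by norm_num) (by decide +kernel) (by norm_num) (by norm_num) (by norm_num)
    (by norm_num) (n₂ := 515) card_479 (by norm_num) (by norm_num)
    Dt β ι d hne

end C21443a1

namespace C12279a1

/-- **DEPTH-TWO ROW `12279a1`, `(p, d_K, ℓ₁ℓ₂) = (5, -47, 179·229)`, twist-free, without Kolyvagin's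
structure theorem, NO SYSTEM (bit at ANY datum).** For `E = 12279a1` (rank `3`), ANY imaginary quadratic `K` with `d_K = -47`, any frame
`(Dt, β, ι)` and ANY single Kolyvagin–Heegner datum `d` (no system, no coherence binders), granted the five named leaves
(Gross Prop. 5.4 (2); McCallum Lemma 4.3, Prop. 4.4, Lemma 5.3, Prop. 2.2): IF
`d.kolyvaginClass _ 1 ≠ 0` (`d` of conductor `179·229`) THEN `corank_{ℤ_5} Ш(E)[5^∞] = 0`, `rank_ℤ E(ℚ) = 3`,
`rank_ℤ E^{(-47)}(ℚ) ≤ 2`, `E(ℚ)[5] = 0`, `Ш(E/ℚ)[5] = 0`, `#Sel^(5)(E/ℚ) = 5³`, `#Sel^(5)(E^{(-47)}/ℚ) ≤ 5²`.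
Every side condition is a kernel theorem. CONDITIONAL on the five facts and the bit; per-curve; BSD is not
proved by it. [cite: Kolyvagin1991MathAnn, Thm. 2.3] [cite: McCallumLMS1991, §§2–5]
[cite: GrossLMS1991, §5 (5.1)] [cite: CremonaAlgorithms1997, Table 1 (12279a1)] -/
theorem depthRow_5_neg47_179_229_ofDatum
    (h54 : sign_conjAct_kolyvaginClass) (h43 : lemma43_kolyvaginClass_mem_selmerLocalKer)
    (h44 : prop44_localOrder_kolyvaginClass_mul_eq) (h53 : lemma53_selmer_eigen_dependent_at)
    (h22 : prop22_reciprocity_eigen_finset)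
    (K : Type) [Field K] [NumberField K] (hK : IsImaginaryQuadratic K)
    (hD : NumberField.discr K = -47) :
    haveI := isElliptic_of_mem_atlasR3A00 mem_atlas;
    haveI := isGloballyMinimal_of_mem_atlasR3A00 mem_atlas;
    haveI : NeZero ((c12279a1.e.baseChange ℚ).conductorNorm ℤ) := neZero_conductorNorm_of_isElliptic _;
    ∀ (Dt : ModularParametrizationData (c12279a1.e.baseChange ℚ) ((c12279a1.e.baseChange ℚ).conductorNorm ℤ))
      (β : ℤ) (ι : K →+* ℂ) (d : KolyvaginHeegnerData Dt β ι (179 * 229)),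
    d.kolyvaginClass (p := 5) (by norm_num) 1 ≠ 0 →
    (c12279a1.e.baseChange ℚ).shaCorank 5 = 0 ∧ (c12279a1.e.baseChange ℚ).mordellWeilRank = 3 ∧
      ((c12279a1.e.baseChange ℚ).quadraticTwist ((-47 : ℤ) : ℚ)).mordellWeilRank ≤ 2 ∧
      (∀ P : (c12279a1.e.baseChange ℚ).toAffine.Point, 5 • P = 0 → P = 0) ∧
      (∀ x ∈ (c12279a1.e.baseChange ℚ).sha, 5 • x = 0 → x = 0) ∧
      Nat.card ↥(selmerGroup (c12279a1.e.baseChange ℚ) ((5 : ℕ) : ℤ)) = 5 ^ 3 ∧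
      Nat.card ↥(selmerGroup ((c12279a1.e.baseChange ℚ).quadraticTwist ((-47 : ℤ) : ℚ)) ((5 : ℕ) : ℤ)) ≤ 5 ^ 2 := by
  haveI := isElliptic_of_mem_atlasR3A00 mem_atlas
  haveI := isGloballyMinimal_of_mem_atlasR3A00 mem_atlas
  haveI : NeZero ((c12279a1.e.baseChange ℚ).conductorNorm ℤ) := neZero_conductorNorm_of_isElliptic _
  intro Dt β ι d hne
  haveI := Fact.mk (by norm_num : Nat.Prime 5)
  exact depthRowTwo_noTwist_of_datum_of_intModel_certificate intModel h54 h43 h44 h53 h22 not_hasCM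
    three_le_rank 5 (by norm_num) hasSurjectiveModNGaloisRep_pow_5 K hK hD (by norm_num) (by norm_num)
    heegner_neg47
    179 (by norm_num) (by norm_num) (by decide +kernel) (by norm_num) (by norm_num) (by norm_num)
    (by norm_num) (n₁ := 195) card_179 (by norm_num)
    229 (by norm_num) (by norm_num) (by decide +kernel) (by norm_num) (by norm_num) (by norm_num)
    (by norm_num) (n₂ := 230) card_229 (by norm_num) (by norm_num)
    Dt β ι d hne

end C12279a1

end Summit.BirchSwinnertonDyer.BirchSwinnertonDyer.Theorems.KolyvaginDepthDoor

end
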